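import Summits.CriticalPhenomena.Ising3DConformalLimit.Theses.BallSpecification
import Literature.Probability.LatticeModels.MoebiusWeightedAction
import HarnessLib

/-!
# Stub `stub_transportBasics` of line `birth` (skeleton r2) for crux `BallSpecifiedInversionUpgrade` (stmt-CriticalPhenomena-11248)

Route `route-CriticalPhenomena-BallSpecification`, sub-problem `Ising3DConformalLimit`.  Target tree file:
`Summits/CriticalPhenomena/Ising3DConformalLimit/Theorems/BallSpecificationBallSpecifiedInversionUpgradeTransportBasics.lean`,
landed with `--supports stmt-CriticalPhenomena-11248` (the theorem name and statement below are the REGISTERED stub; do not change them).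
-/

namespace Summit.CriticalPhenomena.Ising3DConformalLimit.BallSpecificationBallSpecifiedInversionUpgrade

open MeasureTheory
open Literature.MathematicalPhysics.QuantumLattice Literature.Probability.LatticeModels

/-! ### Private helpers (prefix `tb_`) -/

/-- The annuli `R_s = {s < ‖x‖ < s⁻¹}` decrease in `s` (for `0 < s`). [folklore] -/
private theorem tb_annulus_mono {s s' : ℝ} (hs : 0 < s) (hss' : s ≤ s') :
    {x : EuclideanSpace ℝ (Fin 3) | s' < ‖x‖ ∧ ‖x‖ < s'⁻¹} ⊆
      {x : EuclideanSpace ℝ (Fin 3) | s < ‖x‖ ∧ ‖x‖ < s⁻¹} :=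
  fun _ hx => ⟨lt_of_le_of_lt hss' hx.1, lt_of_lt_of_le hx.2 (inv_anti₀ hs hss')⟩

/-- The annulus `R_s` misses the origin (for `0 < s`). [folklore] -/
private theorem tb_annulus_subset_compl_zero {s : ℝ} (hs : 0 < s) :
    {x : EuclideanSpace ℝ (Fin 3) | s < ‖x‖ ∧ ‖x‖ < s⁻¹} ⊆
      (({0} : Set (EuclideanSpace ℝ (Fin 3)))ᶜ) :=
  fun _ hx => Set.mem_compl_singleton_iff.2 (norm_pos_iff.1 (hs.trans hx.1))

/-- A test function whose topological support lies in an annulus `R_s` has compact support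
(closed and bounded in the proper space `ℝ³`). [folklore] -/
private theorem tb_hasCompactSupport_of_subset_annulus {s : ℝ}
    {f : SchwartzMap (EuclideanSpace ℝ (Fin 3)) ℝ}
    (hf : tsupport (f : EuclideanSpace ℝ (Fin 3) → ℝ) ⊆
      {x : EuclideanSpace ℝ (Fin 3) | s < ‖x‖ ∧ ‖x‖ < s⁻¹}) :
    HasCompactSupport (f : EuclideanSpace ℝ (Fin 3) → ℝ) := by
  refine Metric.isCompact_of_isClosed_isBounded (isClosed_tsupport _)
    ((Metric.isBounded_ball (x := (0 : EuclideanSpace ℝ (Fin 3))) (r := s⁻¹)).subset ?_)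
  intro x hx
  rw [Metric.mem_ball, dist_zero_right]
  exact (hf hx).2

/-- **σ-algebra induction for consistency.** If two maps of field configurations agree when
tested against every test function supported in `U`, they have the same preimage of every event
seen in `U` (`extEvents U` is generated by these evaluations). [folklore] -/
private theorem tb_preimage_eq_of_extEvents {U : Set (EuclideanSpace ℝ (Fin 3))}
    {T T' : FieldConfig (EuclideanSpace ℝ (Fin 3)) → FieldConfig (EuclideanSpace ℝ (Fin 3))}
    (h : ∀ f : SchwartzMap (EuclideanSpace ℝ (Fin 3)) ℝ,
      tsupport (f : EuclideanSpace ℝ (Fin 3) → ℝ) ⊆ U → ∀ ω, T ω f = T' ω f)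
    {A : Set (FieldConfig (EuclideanSpace ℝ (Fin 3)))} (hA : MeasurableSet[extEvents U] A) :
    T ⁻¹' A = T' ⁻¹' A := by
  -- The sets on which `T` and `T'` have the same preimage form a σ-algebra; it contains the
  -- generators `(ω ↦ ω f) ⁻¹' t` (`tsupport f ⊆ U`) of `extEvents U`, hence all of `extEvents U`.
  suffices hle : extEvents U ≤
      { MeasurableSet' := fun B => T ⁻¹' B = T' ⁻¹' B
        measurableSet_empty := rfl
        measurableSet_compl := fun B hB => by
          show T ⁻¹' Bᶜ = T' ⁻¹' Bᶜ
          rw [Set.preimage_compl, Set.preimage_compl, hB]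
        measurableSet_iUnion := fun B hB => by
          show T ⁻¹' (⋃ i, B i) = T' ⁻¹' (⋃ i, B i)
          rw [Set.preimage_iUnion, Set.preimage_iUnion]
          exact Set.iUnion_congr hB } from
    hle A hA
  refine iSup₂_le fun f hf => ?_
  intro B hB
  obtain ⟨t, -, rfl⟩ := MeasurableSpace.measurableSet_comap.1 hB
  show T ⁻¹' ((fun ω : FieldConfig (EuclideanSpace ℝ (Fin 3)) => ω f) ⁻¹' t) =
    T' ⁻¹' ((fun ω : FieldConfig (EuclideanSpace ℝ (Fin 3)) => ω f) ⁻¹' t)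
  ext ω
  rw [Set.mem_preimage, Set.mem_preimage, Set.mem_preimage, Set.mem_preimage, h f hf ω]

/-- The product integrand `ω ↦ ∏ᵢ ω (f i)` of a moment is measurable. [folklore] -/
private theorem tb_measurable_prod_eval {n : ℕ}
    (f : Fin n → SchwartzMap (EuclideanSpace ℝ (Fin 3)) ℝ) :
    Measurable fun ω : FieldConfig (EuclideanSpace ℝ (Fin 3)) => ∏ i, ω (f i) :=
  Finset.measurable_prod _ fun i _ => measurable_eval (f i)

/-- Registered stub `stub_transportBasics` of crux `BallSpecifiedInversionUpgrade` (stmt-CriticalPhenomena-11248), line `birth` r2. -/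
theorem stub_transportBasics :
    ∀ (Δ : ℝ) (μ : MeasureTheory.Measure (Literature.MathematicalPhysics.QuantumLattice.FieldConfig (EuclideanSpace ℝ (Fin 3)))) (P : ℝ → (SchwartzMap (EuclideanSpace ℝ (Fin 3)) ℝ →L[ℝ] SchwartzMap (EuclideanSpace ℝ (Fin 3)) ℝ)), MeasureTheory.IsProbabilityMeasure μ → (∀ s : ℝ, 0 < s → s < 1 → ∀ f : SchwartzMap (EuclideanSpace ℝ (Fin 3)) ℝ, HasCompactSupport (f : EuclideanSpace ℝ (Fin 3) → ℝ) → tsupport (f : EuclideanSpace ℝ (Fin 3) → ℝ) ⊆ {x : EuclideanSpace ℝ (Fin 3) | s < ‖x‖ ∧ ‖x‖ < s⁻¹} → P s f = Literature.Probability.LatticeModels.moebiusWeightedAction Literature.Probability.LatticeModels.ConformalChart.unitInversion Δ f) → (∀ f : SchwartzMap (EuclideanSpace ℝ (Fin 3)) ℝ, HasCompactSupport (f : EuclideanSpace ℝ (Fin 3) → ℝ) → MeasureTheory.MemLp (fun ω : Literature.MathematicalPhysics.QuantumLattice.FieldConfig (EuclideanSpace ℝ (Fin 3)) => ω f) 2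 μ) → (∀ f : SchwartzMap (EuclideanSpace ℝ (Fin 3)) ℝ, ∫ ω, ω f ∂μ = 0) → (∀ f : SchwartzMap (EuclideanSpace ℝ (Fin 3)) ℝ, HasCompactSupport (f : EuclideanSpace ℝ (Fin 3) → ℝ) → tsupport (f : EuclideanSpace ℝ (Fin 3) → ℝ) ⊆ (({0} : Set (EuclideanSpace ℝ (Fin 3)))ᶜ) → ∫ ω, (ω (Literature.Probability.LatticeModels.moebiusWeightedAction Literature.Probability.LatticeModels.ConformalChart.unitInversion Δ f)) ^ 2 ∂μ = ∫ ω, (ω f) ^ 2 ∂μ) → (∀ s s' : ℝ, 0 < s → s ≤ s' → s' < 1 → ∀ A, MeasurableSet[Literature.MathematicalPhysics.QuantumLattice.extEvents {x : EuclideanSpace ℝ (Fin 3) | s' < ‖x‖ ∧ ‖x‖ < s'⁻¹}] A → (MeasureTheory.Measure.map (Literature.MathematicalPhysics.QuantumLattice.FieldConfig.act (P s)) μ) A = (MeasureTheory.Measure.map (Literature.MathematicalPhysics.QuantumLattice.FieldConfig.act (P s')) μ) A) ∧ (∀ s : ℝ, 0 < s → s < 1 → MeasureTheory.IsProbabilityMeasure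 (MeasureTheory.Measure.map (Literature.MathematicalPhysics.QuantumLattice.FieldConfig.act (P s)) μ)) ∧ (∀ s : ℝ, 0 < s → s < 1 → ∀ f : SchwartzMap (EuclideanSpace ℝ (Fin 3)) ℝ, HasCompactSupport (f : EuclideanSpace ℝ (Fin 3) → ℝ) → tsupport (f : EuclideanSpace ℝ (Fin 3) → ℝ) ⊆ {x : EuclideanSpace ℝ (Fin 3) | s < ‖x‖ ∧ ‖x‖ < s⁻¹} → MeasureTheory.MemLp (fun ω : Literature.MathematicalPhysics.QuantumLattice.FieldConfig (EuclideanSpace ℝ (Fin 3)) => ω f) 2 (MeasureTheory.Measure.map (Literature.MathematicalPhysics.QuantumLattice.FieldConfig.act (P s)) μ) ∧ ∫ ω, ω f ∂(MeasureTheory.Measure.map (Literature.MathematicalPhysics.QuantumLattice.FieldConfig.act (P s)) μ) = 0 ∧ ∫ ω, (ω f) ^ 2 ∂(MeasureTheory.Measure.map (Literature.MathematicalPhysics.QuantumLattice.FieldConfig.act (P s)) μ) ≤ 1 * ∫ ω, (ω f) ^ 2 ∂μ) ∧ (∀ s : ℝ, 0 < s → s < 1 → ∀ (n : ℕ) (f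 : Fin n → SchwartzMap (EuclideanSpace ℝ (Fin 3)) ℝ), (∀ i, (HasCompactSupport (f i : EuclideanSpace ℝ (Fin 3) → ℝ) ∧ tsupport (f i : EuclideanSpace ℝ (Fin 3) → ℝ) ⊆ {x : EuclideanSpace ℝ (Fin 3) | s < ‖x‖ ∧ ‖x‖ < s⁻¹})) → Literature.MathematicalPhysics.QuantumLattice.moment (MeasureTheory.Measure.map (Literature.MathematicalPhysics.QuantumLattice.FieldConfig.act (P s)) μ) n f = Literature.MathematicalPhysics.QuantumLattice.moment μ n (fun i => Literature.Probability.LatticeModels.moebiusWeightedAction Literature.Probability.LatticeModels.ConformalChart.unitInversion Δ (f i))) := by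
  intro Δ μ P hμ hP3 hL2 hmean hdom
  refine ⟨?_, ?_, ?_, ?_⟩
  · -- (1) consistency on `extEvents R_{s'}` for `s ≤ s'`
    intro s s' hs hss' hs'1 A hA
    have hs1 : s < 1 := lt_of_le_of_lt hss' hs'1
    have hs' : 0 < s' := lt_of_lt_of_le hs hss'
    have hA' : MeasurableSet A := extEvents_le _ A hA
    rw [Measure.map_apply (FieldConfig.measurable_act _) hA',
      Measure.map_apply (FieldConfig.measurable_act _) hA']
    congr 1
    refine tb_preimage_eq_of_extEvents (fun f hf ω => ?_) hA
    have hfc : HasCompactSupport (f : EuclideanSpace ℝ (Fin 3) → ℝ) :=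
      tb_hasCompactSupport_of_subset_annulus hf
    rw [FieldConfig.act_apply, FieldConfig.act_apply,
      hP3 s hs hs1 f hfc (hf.trans (tb_annulus_mono hs hss')), hP3 s' hs' hs'1 f hfc hf]
  · -- (2) probability
    intro s _ _
    exact Measure.isProbabilityMeasure_map (FieldConfig.measurable_act _).aemeasurable
  · -- (3) the low-order class with `C = 1`
    intro s hs hs1 f hfc hf
    have hPs : P s f = moebiusWeightedAction ConformalChart.unitInversion Δ f :=
      hP3 s hs hs1 f hfc hf
    refine ⟨?_, ?_, ?_⟩
    · refine (memLp_map_measure_iff (measurable_eval f).aestronglyMeasurable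
        (FieldConfig.measurable_act _).aemeasurable).2 ?_
      have key : (fun ω : FieldConfig (EuclideanSpace ℝ (Fin 3)) => ω f) ∘
          ⇑(FieldConfig.act (P s)) = fun ω : FieldConfig (EuclideanSpace ℝ (Fin 3)) =>
            ω (moebiusWeightedAction ConformalChart.unitInversion Δ f) := by
        funext ω
        rw [Function.comp_apply, FieldConfig.act_apply, hPs]
      rw [key]
      exact hL2 _ (hasCompactSupport_moebiusWeightedAction f)
    · rw [MeasureTheory.integral_map (FieldConfig.measurable_act _).aemeasurable
        (measurable_eval f).aestronglyMeasurable]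
      simp only [FieldConfig.act_apply, hPs]
      exact hmean _
    · rw [one_mul, MeasureTheory.integral_map (FieldConfig.measurable_act _).aemeasurable
        ((measurable_eval f).pow_const 2).aestronglyMeasurable]
      simp only [FieldConfig.act_apply, hPs]
      rw [hdom f hfc (hf.trans (tb_annulus_subset_compl_zero hs))]
  · -- (4) inverted moments
    intro s hs hs1 n f hf
    unfold moment
    rw [MeasureTheory.integral_map (FieldConfig.measurable_act _).aemeasurable
      (tb_measurable_prod_eval f).aestronglyMeasurable]
    refine integral_congr_ae (Filter.Eventually.of_forall fun ω => ?_)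
    refine Finset.prod_congr rfl fun i _ => ?_
    rw [FieldConfig.act_apply, hP3 s hs hs1 (f i) (hf i).1 (hf i).2]

end Summit.CriticalPhenomena.Ising3DConformalLimit.BallSpecificationBallSpecifiedInversionUpgrade
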